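import Summits.QuantumAdvantage.QuantumAdvantage.Theorems.CharDialTableDialA

/-!
# CharDialTableDialB — TREE PART B of the decomp-qadv lens-5 g30 node «TableDial» on `CharDial.FrobStructureLawOdd`
# (stmt-QuantumAdvantage-27205): the bridge from the seed (`baseAt_of_seed_tab : SeedAt p → TabAt p → BaseAt p`, the located residuals
# `baseAt_seven_of_core_seed` / `baseAt_five_of_core_seed`), necessity of every piece, `closes` BY NAME, the exact splits
# `exchCoreAt_iff_pieces : ExchCoreAt p ↔ SeedAt p ∧ TabAt p ∧ GlueAt p` and `target_iff_pieces : FrobStructureLawOdd ↔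
# SeedOdd ∧ TabOdd ∧ GlueOdd ∧ IslandOdd`, the pair-Ramsey rung `seedAt_of_fewAt`, and the numbers.  Verbatim from the node file
# (namespace `Theses.TableDial → Theorems.TableDial`), part A imported.
-/

set_option autoImplicit false
set_option linter.dupNamespace false

namespace Summit.QuantumAdvantage.QuantumAdvantage.Theorems.TableDial

open Finset
open Summit.QuantumAdvantage.AdviceFreeQNC0
open Literature.Computability.MetaComplexity Literature.Computability.MetaComplexity.Smolensky
open Summit.QuantumAdvantage.QuantumAdvantage.Theorems.IslandDial (Exch TopConst ExchCoreAt ExchCoreOdd IslandAt IslandOdd)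
open Summit.QuantumAdvantage.QuantumAdvantage.Theorems.LevelDial (RPrimeAt nB BaseAt BaseOdd TailAt GlueAt GlueOdd
  depOn_slice hasDegF_slice topConst_slice exch_mono exch_of_two_slices tail_of_base)

/-! ### §5 The bridge bites from the seed -/

section Seed

variable {p : ℕ} [hp : Fact p.Prime]

/-- A seed level is an R′ level, once the table law holds at every co-size. -/
theorem rPrimeAt_of_seedLevel {K m : ℕ} (hall : ∀ L : ℕ, TabLaw p K L) (hseed : SeedLevel p m) : RPrimeAt p K m := by
  intro n f X hXc hdep hf hγ
  obtain ⟨R, hRX, hRp, hexR⟩ := hseed n f X hXc hdep hf hγ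
  obtain ⟨Y, hYX, hYc, hYex⟩ := hall X.card n f X R hRX hRp (by omega) hdep hf hγ hexR
  exact ⟨Y, hYX, by omega, hYex⟩

/-- **SEED + TABLE CORE ⟹ FINITE RANGE (kernel).** -/
theorem baseAt_of_seed_tab (hS : SeedAt p) (hT : TabAt p) : BaseAt p := by
  obtain ⟨K, hcore⟩ := hT
  obtain ⟨m, hm, hseed⟩ := hS (2 * K + (p - 1))
  exact baseAt_of_levels (tail_of_core hcore hm (rPrimeAt_of_seedLevel (tabLaw_all_of_core hcore) hseed))

/-- … hence piece E at `p`, with the glue of g29 (tree `LevelDial.exchCoreAt_of_pieces`). -/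
theorem exchCoreAt_of_seed_tab_glue (hS : SeedAt p) (hT : TabAt p) (hG : GlueAt p) : ExchCoreAt p :=
  Summit.QuantumAdvantage.QuantumAdvantage.Theorems.LevelDial.exchCoreAt_of_pieces p (baseAt_of_seed_tab hS hT) hG

/-- LOCATED RESIDUAL at `p = 7` (census budget `K₀(7) = 4`, core co-size `9`, climb threshold `2·4 + 6 = 14`): the certified core
and ONE seed level `m ≥ 14` give the finite range at `7`. -/
theorem baseAt_seven_of_core_seed [Fact (Nat.Prime 7)] (hcore : TabLaw 7 4 9) {m : ℕ} (hm : 14 ≤ m)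
    (hseed : SeedLevel 7 m) : BaseAt 7 :=
  baseAt_of_levels (tail_of_core hcore hm (rPrimeAt_of_seedLevel (tabLaw_all_of_core hcore) hseed))

/-- … and at `p = 5` (census budget `K₀(5) = 1`, core co-size `3`, climb threshold `6`). -/
theorem baseAt_five_of_core_seed [Fact (Nat.Prime 5)] (hcore : TabLaw 5 1 3) {m : ℕ} (hm : 6 ≤ m)
    (hseed : SeedLevel 5 m) : BaseAt 5 :=
  baseAt_of_levels (tail_of_core hcore hm (rPrimeAt_of_seedLevel (tabLaw_all_of_core hcore) hseed))

end Seed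

/-! ### §6 Necessity of every piece, `closes`, exactness -/

section Exact

variable {p : ℕ} [hp : Fact p.Prime]

/-- Piece E at `p` gives the table law at every budget pair (drop the block hypothesis). -/
theorem tabAt_of_exchCoreAt (hE : ExchCoreAt p) : TabAt p := by
  obtain ⟨E, hE⟩ := hE
  exact ⟨E, fun n f X R _ _ _ _ hf hγ _ => hE n f X hf hγ⟩

/-- Piece E at `p` gives the seed (at every level `≥ E + (p − 1)`). -/
theorem seedAt_of_exchCoreAt (hE : ExchCoreAt p) : SeedAt p := by
  obtain ⟨E, hE⟩ := hE
  intro m₀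
  refine ⟨m₀ + E + (p - 1), by omega, fun n f X hXc _ hf hγ => ?_⟩
  obtain ⟨Y, hYX, hYc, hYex⟩ := hE n f X hf hγ
  exact ⟨Y, hYX, by omega, hYex⟩

/-- The seed is already implied by g29's finite range alone (bridge `tail_of_base`): it is the WEAKER half of B. -/
theorem seedAt_of_baseAt (hB : BaseAt p) : SeedAt p := by
  obtain ⟨K, hK⟩ := hB
  intro m₀
  refine ⟨m₀ + nB p K, by omega, fun n f X hXc hdep hf hγ => ?_⟩
  obtain ⟨Y, hYX, hYc, hYex⟩ := tail_of_base hK _ (by omega) n f X hXc hdep hf hγ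
  have hnB : nB p K = 2 * K + 1 + max p (K + 1) := rfl
  exact ⟨Y, hYX, by rw [hnB] at hYc hXc; omega, hYex⟩

/-- Piece E at `p` gives the rung `FewAt p` (an exchangeable `Y` meets a pairwise non-exchangeable set in at most one point). -/
theorem fewAt_of_exchCoreAt (hE : ExchCoreAt p) : FewAt p := by
  classical
  obtain ⟨E, hE⟩ := hE
  refine ⟨E + 1, fun n f X _ hf hγ A hAX hA => ?_⟩
  obtain ⟨Y, hYX, hYc, hYex⟩ := hE n f X hf hγ
  have h1 : (A ∩ Y).card ≤ 1 := Finset.card_le_one.2 fun i hi j hj => by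
    by_contra hij
    exact hA i (Finset.mem_inter.1 hi).1 j (Finset.mem_inter.1 hj).1 hij
      (hYex i (Finset.mem_inter.1 hi).2 j (Finset.mem_inter.1 hj).2)
  have h2 : (A \ Y).card ≤ (X \ Y).card := Finset.card_le_card (Finset.sdiff_subset_sdiff hAX (subset_refl _))
  have h3 : (X \ Y).card + Y.card = X.card := Finset.card_sdiff_add_card_eq_card hYX
  have h4 : (A \ Y).card + (A ∩ Y).card = A.card := Finset.card_sdiff_add_card_inter A Y
  omega

/-- ★ Piece E at `p` ⟺ seed ∧ table core ∧ glue at `p`. -/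
theorem exchCoreAt_iff_pieces (p : ℕ) [Fact p.Prime] : ExchCoreAt p ↔ (SeedAt p ∧ TabAt p ∧ GlueAt p) :=
  ⟨fun hE => ⟨seedAt_of_exchCoreAt hE, tabAt_of_exchCoreAt hE,
      Summit.QuantumAdvantage.QuantumAdvantage.Theorems.LevelDial.glueAt_of_exchCoreAt p hE⟩,
    fun h => exchCoreAt_of_seed_tab_glue h.1 h.2.1 h.2.2⟩

/-- g29's finite range from the two new pieces, over the odd primes. -/
theorem baseOdd_of_seed_tab (hS : SeedOdd) (hT : TabOdd) : BaseOdd := fun p _ hp5 => baseAt_of_seed_tab (hS p hp5) (hT p hp5)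

/-- **`closes`**: the four pieces decide the target BY NAME (via the tree's `LevelDial.closes`). -/
theorem closes (hS : SeedOdd) (hT : TabOdd) (hG : GlueOdd) (hI : IslandOdd) :
    Summit.QuantumAdvantage.QuantumAdvantage.Theses.CharDial.FrobStructureLawOdd :=
  Summit.QuantumAdvantage.QuantumAdvantage.Theorems.LevelDial.closes (baseOdd_of_seed_tab hS hT) hG hI

/-- Necessity of the seed. -/
theorem seedOdd_of_target (hT : Summit.QuantumAdvantage.QuantumAdvantage.Theses.CharDial.FrobStructureLawOdd) : SeedOdd :=
  fun p _ hp5 => seedAt_of_exchCoreAt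
    (Summit.QuantumAdvantage.QuantumAdvantage.Theorems.IslandDial.exchCoreOdd_of_target hT p hp5)

/-- Necessity of the table law. -/
theorem tabOdd_of_target (hT : Summit.QuantumAdvantage.QuantumAdvantage.Theses.CharDial.FrobStructureLawOdd) : TabOdd :=
  fun p _ hp5 => tabAt_of_exchCoreAt
    (Summit.QuantumAdvantage.QuantumAdvantage.Theorems.IslandDial.exchCoreOdd_of_target hT p hp5)

/-- Necessity of the rung. -/
theorem fewOdd_of_target (hT : Summit.QuantumAdvantage.QuantumAdvantage.Theses.CharDial.FrobStructureLawOdd) : FewOdd :=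
  fun p _ hp5 => fewAt_of_exchCoreAt
    (Summit.QuantumAdvantage.QuantumAdvantage.Theorems.IslandDial.exchCoreOdd_of_target hT p hp5)

/-- **EXACT SPLIT**: the target is equivalent to the conjunction of the four pieces. -/
theorem target_iff_pieces :
    Summit.QuantumAdvantage.QuantumAdvantage.Theses.CharDial.FrobStructureLawOdd ↔ (SeedOdd ∧ TabOdd ∧ GlueOdd ∧ IslandOdd) :=
  ⟨fun hT => ⟨seedOdd_of_target hT, tabOdd_of_target hT,
      Summit.QuantumAdvantage.QuantumAdvantage.Theorems.LevelDial.glueOdd_of_target hT,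
      Summit.QuantumAdvantage.QuantumAdvantage.Theorems.IslandDial.islandOdd_of_target hT⟩,
    fun h => closes h.1 h.2.1 h.2.2.1 h.2.2.2⟩

/-- The refinement of g29's piece B read both ways against piece E: `B ∧ G ⟺ Seed ∧ Tab ∧ G` at `p`. -/
theorem baseAt_glueAt_iff (p : ℕ) [Fact p.Prime] : (BaseAt p ∧ GlueAt p) ↔ (SeedAt p ∧ TabAt p ∧ GlueAt p) := by
  rw [← Summit.QuantumAdvantage.QuantumAdvantage.Theorems.LevelDial.exchCoreAt_iff, exchCoreAt_iff_pieces]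

end Exact

/-! ### §7 The rung: boundedly many classes ⟹ the seed, by pair Ramsey -/

section Ramsey

variable {p : ℕ} [hp : Fact p.Prime]

/-- **FewAt ⟹ SeedAt** (tree `SubChar.ramsey` on pairs, colour = «exchangeable pair»): among `R(p − 1, a + 1)` coordinates of a class
member there are `p − 1` pairwise exchangeable ones or `a + 1` pairwise non-exchangeable ones, and the rung forbids the latter. -/
theorem seedAt_of_fewAt (hF : FewAt p) : SeedAt p := by
  classical
  obtain ⟨a, ha⟩ := hF
  obtain ⟨N, hN⟩ := SubChar.ramsey 2 (p - 1) (a + 1)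
  intro m₀
  refine ⟨max N m₀, le_max_right _ _, fun n f X hXc hdep hf hγ => ?_⟩
  rcases hN (Fin n) X (fun T => decide (Exch f T)) (by rw [hXc]; exact le_max_left _ _) with
    ⟨S, hSX, hSc, hS⟩ | ⟨S, hSX, hSc, hS⟩
  · refine ⟨S, hSX, hSc, fun i hi j hj u => ?_⟩
    by_cases hij : i = j
    · rw [hij]
      exact SubChar.swapInv_self f j u
    · have hT : decide (Exch f ({i, j} : Finset (Fin n))) = true :=
        hS {i, j} (Finset.insert_subset_iff.2 ⟨hi, Finset.singleton_subset_iff.2 hj⟩) (Finset.card_pair hij)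
      exact of_decide_eq_true hT i (by simp) j (by simp) u
  · exfalso
    have hanti : ∀ i ∈ S, ∀ j ∈ S, i ≠ j → ¬ (∀ u : Fin n → Bool, f (u ∘ Equiv.swap i j) = f u) := by
      intro i hi j hj hij hswap
      have hT : decide (Exch f ({i, j} : Finset (Fin n))) = false :=
        hS {i, j} (Finset.insert_subset_iff.2 ⟨hi, Finset.singleton_subset_iff.2 hj⟩) (Finset.card_pair hij)
      exact (decide_eq_false_iff_not.1 hT) (exch_pair hswap)
    have := ha n f X hdep hf hγ S hSX hanti
    omega

/-- The rung decides the seed over the odd primes. -/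
theorem seedOdd_of_fewOdd (hF : FewOdd) : SeedOdd := fun p _ hp5 => seedAt_of_fewAt (hF p hp5)

/-- `closes` through the rung. -/
theorem closes_few (hF : FewOdd) (hT : TabOdd) (hG : GlueOdd) (hI : IslandOdd) :
    Summit.QuantumAdvantage.QuantumAdvantage.Theses.CharDial.FrobStructureLawOdd :=
  closes (seedOdd_of_fewOdd hF) hT hG hI

end Ramsey

/-! ### §8 Numbers: how far the finite range must reach -/

/-- Core co-size and climb threshold at `p = 5`, `K₀(5) = 1`: `3` and `6`; at `p = 7`, `K₀(7) = 4`: `9` and `14`.  The census K41 A3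
enumerated the collapsed model at `p = 7` exactly up to junta size `9`. -/
theorem numbers : (2 * 1 + 1 = 3 ∧ 2 * 1 + (5 - 1) = 6) ∧ (2 * 4 + 1 = 9 ∧ 2 * 4 + (7 - 1) = 14) := by decide

/-- g29's base level dominates the climb threshold: `nB p K ≥ 2K + (p − 1)` (so the core also re-proves g29's bridge shape). -/
theorem nB_ge_climb (p K : ℕ) : 2 * K + (p - 1) ≤ nB p K := by
  have hnB : nB p K = 2 * K + 1 + max p (K + 1) := rfl
  rw [hnB]; omega

end Summit.QuantumAdvantage.QuantumAdvantage.Theorems.TableDial
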